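/-
Copyright (c) 2026 the pub-hodgecm-mathlib formalisation cell (harness21).  Prover seat hodgecm-mathlib-K2Liu-p09 (g5): Track B «K2-LIT»,
hLiu418 = stmt-HodgeConjecture-24832; LEAD F0P6-plan RULINGS M-156m∕o, M-157a (4)∕m «A7 = GK COCYCLE ROAD», file B7-CC.
-/
import Summits.HodgeConjecture.HodgeConjecture.Theorems.K2LiuSiegelCocycleChainShort       -- ★ B7-CB (+ B7-V, B7-A, B7-B, B4d-1b)
import HarnessLib

/-!
# Crux `HLiu418`, road `K2_Liu`, organ A7-reg (GK cocycle road), file B7-CC: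
# THE CHAIN BEFORE THE LAST STEP — the long-root `hrel` datum of `F₄ = κ″ · ℬF″` (non-split) and of `F₄ = κ″ · ℬ_{w₁} F₃` (split)

Cell `hodgecm-mathlib`, crux item hLiu418 = `stmt-HodgeConjecture-24832`; squad K2 ∕ K2Liu; prover K2Liu-p09 (g5).  THEOREMS ONLY; lane
`--supports stmt-HodgeConjecture-24832` (count-neutral helper).  ONE FRAME (RULING M-156o (c)).
THE POINT.  The last operator `A₂` of `M_v(s) = A₂ A₁ A₂` acts on the output of the middle stage.  With `F′` a Siegel section for `(χ⁰_v, s₀)`, `F″ = κ 𝒜F′` (★ B7-CB), and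
* (non-split, `w` the only place above `v`) `F₄(g) = κ″ ∫_{E_w} F″(φ(P_w) φ(u₋(1_w ζ)) g) dζ`,
* (split, places `w₁ ≠ w₂`) `F₃ = κ′ ℬ_{w₂} F″` (★ B7-CB §3) and `F₄(g) = κ″ ∫_{E_{w₁}} F₃(φ(P_{w₁}) φ(u₋(1_{w₁} ζ)) g) dζ`,
`F₄` is invariant under `φ(u_{2e₂}(·))` (★ B7-B §2) and has the swapped torus law (★ B7-B §3), whose value on `(1, −X⁻¹)`, `X = ι_v(x)δ`, is
`χ⁰_s₀(φ t(−X⁻¹, 1)) · ∏_w ‖X_w‖` in both cases (the swaps undo the `σ`-twist of ★ B7-A; ★ B7-V `thetaB_atom`).  Hence **the long-root `hrel` of `F₄`**: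
`F₄(φ(w₂) u(x) g) = [χ⁰_s₀(φ t(−δ⁻¹,1)) ∏_w ‖δ_w‖] · χ⁰_{F,v}(x)⁻¹ · |x|_v^{−2s₀} · F₄(ū(x⁻¹) g)` — numerator `L_F(2s₀ − 1, χ⁰_F)`.
HONEST LABEL.  `HC_CM` is proved only modulo the 7 printed citations (2 remaining named inputs: hLiu418 = `stmt-HodgeConjecture-24832`,
h413 = `stmt-HodgeConjecture-24833`) until rung 0 closes.

## References
* [HarrisKudlaSweet1996] M. Harris, S. Kudla, W. J. Sweet, J. AMS 9 (1996), §1 (1.15), §6 (6.14)–(6.16).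
* [Casselman1980] W. Casselman, *The unramified principal series of p-adic groups I*, Compositio Math. 40 (1980), §3 Thm. 3.1.
* [CasselsFrohlichANT1967] J. W. S. Cassels, A. Fröhlich (eds.), *Algebraic Number Theory* (1967), Ch. II §11.
-/

set_option autoImplicit false
set_option linter.dupNamespace false -- the mandated namespace repeats `HodgeConjecture.HodgeConjecture`

noncomputable section

open scoped Classical NNReal
open NumberField IsDedekindDomain Matrix MeasureTheory
open Literature.NumberTheory.GaloisRepresentations.IsNonarchimedeanLocalField
open Literature.NumberTheory.Automorphic Literature.NumberTheory.Automorphic.UnitaryGroup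
open Literature.NumberTheory.GelbartRogawski1991.AdaptedBlocks
open Literature.NumberTheory.GelbartRogawski1991.UnitaryDualPair.LocalSplitting
open Literature.NumberTheory.K2Lit.LocalSiegelDoubled
open Summit.HodgeConjecture.HodgeConjecture.Cruxes.HLiu418.K2LiuLocalLFactorDefs
open Summit.HodgeConjecture.HodgeConjecture.Cruxes.HLiu418.K2LiuLocalSiegelIwasawaFrame
open Summit.HodgeConjecture.HodgeConjecture.Cruxes.HLiu418.K2LiuLocalSiegelIwasawa
open Summit.HodgeConjecture.HodgeConjecture.Cruxes.HLiu418.K2LiuDoubledUTwoTwoBorelFrame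
open Summit.HodgeConjecture.HodgeConjecture.Cruxes.HLiu418.K2LiuDoubledUTwoTwoWeylCocycle
open Summit.HodgeConjecture.HodgeConjecture.Cruxes.HLiu418.K2LiuDoubledUTwoTwoLevi
open Summit.HodgeConjecture.HodgeConjecture.Cruxes.HLiu418.K2LiuDoubledUTwoTwoFrameTransport
open Summit.HodgeConjecture.HodgeConjecture.Cruxes.HLiu418.K2LiuUnipDeltaRankOneCoordinates
open Summit.HodgeConjecture.HodgeConjecture.Cruxes.HLiu418.K2LiuSiegelCocycleLetters
open Summit.HodgeConjecture.HodgeConjecture.Cruxes.HLiu418.K2LiuSiegelCocycleStageLong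
open Summit.HodgeConjecture.HodgeConjecture.Cruxes.HLiu418.K2LiuSiegelCocycleStageShort
open Summit.HodgeConjecture.HodgeConjecture.Cruxes.HLiu418.K2LiuSiegelCocycleValues
open Summit.HodgeConjecture.HodgeConjecture.Cruxes.HLiu418.K2LiuSiegelCocycleChainShort

namespace Summit.HodgeConjecture.HodgeConjecture.Cruxes.HLiu418.K2LiuSiegelCocycleChainLong

variable (F : Type) [Field F] [NumberField F] (E : Type) [Field E] [NumberField E] [Algebra F E]
  [Algebra.IsQuadraticExtension F E] (c : E ≃ₐ[F] E)
  {δ : E} (hcδ : c δ = -δ) (hδ : δ ≠ 0) {d : F} (hd : δ * δ = algebraMap F E d) (v : HeightOneSpectrum (𝓞 F))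
  {T₂ : Matrix (Fin 2) (Fin 2) F} (hT₂ : T₂.IsSymm) {J₂D : Matrix (Fin (2 + 2)) (Fin (2 + 2)) E} (hJ₂D : J₂D = (gramD F 2 T₂).map (algebraMap F E))
  (D Dinv : Matrix (Fin 2) (Fin 2) F) (hDD : D * Dinv = 1) (Q : GL (Fin (2 + 2)) F)
  (hQm : (Q : Matrix (Fin (2 + 2)) (Fin (2 + 2)) F) = Matrix.reindex (e₂ 2) (e₂ 2) (Matrix.fromBlocks 1 D 1 (-D)))
  (hQ : (Q : Matrix (Fin (2 + 2)) (Fin (2 + 2)) F)ᵀ * gramD F 2 T₂ * (Q : Matrix (Fin (2 + 2)) (Fin (2 + 2)) F) = (StdForm.antidiagonal (2 + 2)).over F)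

/-! ## §0 Units of `E ⊗ F_v` when the places above `v` are known -/

section Units

omit [NumberField F] [Algebra.IsQuadraticExtension F E] in
/-- non-split: the `w`-projection is the identity on units. [cite: CasselsFrohlichANT1967, Ch. II §11] -/
theorem proj_eq_self_of_forall_eq {w : PlacesOver E v} (hw : ∀ w' : PlacesOver E v, w' = w) (b : (UnitaryGroup.LocalRing E v)ˣ) :
    Units.map (MonoidHom.mulSingle (fun w' : PlacesOver E v => w'.1.adicCompletion E) w)
        (Units.map (Pi.evalMonoidHom (fun w' : PlacesOver E v => w'.1.adicCompletion E) w) b) = b := by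
  refine Units.ext (funext fun w' => ?_)
  obtain rfl := hw w'
  rw [val_placeUnit, Pi.mulSingle_eq_same]; rfl

omit [Algebra.IsQuadraticExtension F E] in
/-- non-split: `∏_{w′} ‖u_{w′}‖ = ‖u_w‖`. [cite: CasselsFrohlichANT1967, Ch. II §11] -/
theorem prod_norm_of_forall_eq {w : PlacesOver E v} (hw : ∀ w' : PlacesOver E v, w' = w) (u : UnitaryGroup.LocalRing E v) :
    ∏ w' : PlacesOver E v, ‖u w'‖ = ‖u w‖ :=
  Fintype.prod_eq_single w fun w' hw' => absurd (hw w') hw'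

omit [NumberField F] [Algebra.IsQuadraticExtension F E] in
/-- split: the two projections recompose a unit. [cite: CasselsFrohlichANT1967, Ch. II §11] -/
theorem proj_mul_proj_of_pair {w₁ w₂ : PlacesOver E v} (hne : w₁ ≠ w₂) (hw : ∀ w' : PlacesOver E v, w' = w₁ ∨ w' = w₂) (b : (UnitaryGroup.LocalRing E v)ˣ) :
    Units.map (MonoidHom.mulSingle (fun w' : PlacesOver E v => w'.1.adicCompletion E) w₁)
        (Units.map (Pi.evalMonoidHom (fun w' : PlacesOver E v => w'.1.adicCompletion E) w₁) b) *
      Units.map (MonoidHom.mulSingle (fun w' : PlacesOver E v => w'.1.adicCompletion E) w₂)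
        (Units.map (Pi.evalMonoidHom (fun w' : PlacesOver E v => w'.1.adicCompletion E) w₂) b) = b := by
  refine Units.ext (funext fun w' => ?_)
  rw [Units.val_mul, Pi.mul_apply, val_placeUnit, val_placeUnit]
  rcases hw w' with rfl | rfl
  · rw [Pi.mulSingle_eq_same, Pi.mulSingle_eq_of_ne hne, mul_one]; rfl
  · rw [Pi.mulSingle_eq_same, Pi.mulSingle_eq_of_ne (Ne.symm hne), one_mul]; rfl

omit [Algebra.IsQuadraticExtension F E] in
/-- split: `∏_{w′} ‖u_{w′}‖ = ‖u_{w₁}‖ ‖u_{w₂}‖`. [cite: CasselsFrohlichANT1967, Ch. II §11] -/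
theorem prod_norm_of_pair {w₁ w₂ : PlacesOver E v} (hne : w₁ ≠ w₂) (hw : ∀ w' : PlacesOver E v, w' = w₁ ∨ w' = w₂) (u : UnitaryGroup.LocalRing E v) :
    ∏ w' : PlacesOver E v, ‖u w'‖ = ‖u w₁‖ * ‖u w₂‖ := by
  have huniv : (Finset.univ : Finset (PlacesOver E v)) = {w₁, w₂} := by
    ext w'; simpa using hw w'
  rw [huniv, Finset.prod_pair hne]

omit [NumberField F] [Algebra.IsQuadraticExtension F E] in
/-- the `w₁`-projection has trivial `w₂`-component. [cite: CasselsFrohlichANT1967, Ch. II §11] -/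
theorem proj_apply_of_ne {w₁ w₂ : PlacesOver E v} (hne : w₁ ≠ w₂) (b : (UnitaryGroup.LocalRing E v)ˣ) :
    ((Units.map (MonoidHom.mulSingle (fun w' : PlacesOver E v => w'.1.adicCompletion E) w₁)
        (Units.map (Pi.evalMonoidHom (fun w' : PlacesOver E v => w'.1.adicCompletion E) w₁) b) : (UnitaryGroup.LocalRing E v)ˣ) : UnitaryGroup.LocalRing E v) w₂ = 1 := by
  rw [val_placeUnit, Pi.mulSingle_eq_of_ne (Ne.symm hne)]

end Units

variable [MeasurableSpace (v.adicCompletion F)] [BorelSpace (v.adicCompletion F)] (μF : Measure (v.adicCompletion F)) [μF.IsAddHaarMeasure]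
  (χv₀ : ∀ w : PlacesOver E v, (w.1.adicCompletion E)ˣ →* ℂˣ) (s₀ : ℂ)
  {F' : UnitaryGroup.localPi E c (2 + 2) J₂D v → ℂ} (hf : IsLocalSiegelSection F E c hcδ hδ hd v 2 hT₂ hJ₂D χv₀ s₀ F')
  (κ : ℂ) {F'' : UnitaryGroup.localPi E c (2 + 2) J₂D v → ℂ}
  (hF'' : ∀ g, F'' g = κ * ∫ y, F' (FrameTransport.frameConj F E c v (2 + 2) hJ₂D (antidiagonal_over_eq_map F E 2) Q hQ (toLocalFour F E c v (weylTwo (UnitaryGroup.LocalRing E v) (UnitaryGroup.conjLocal E c v))) *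
        FrameTransport.frameConj F E c v (2 + 2) hJ₂D (antidiagonal_over_eq_map F E 2) Q hQ (toLocalFour F E c v (uLongTwo (UnitaryGroup.LocalRing E v) (UnitaryGroup.conjLocal E c v)
          (UnitaryGroup.toLocalRing E v y * algebraMap E (UnitaryGroup.LocalRing E v) δ) (conjLocal_coord F E c hcδ v y))) * g) ∂μF)

/-! ## §1 Non-split: `F₄ = κ″ · ℬ_w F″` -/

section NonSplit

variable (w : PlacesOver E v) (hw : ∀ w' : PlacesOver E v, w' = w)
  [MeasurableSpace (w.1.adicCompletion E)] [BorelSpace (w.1.adicCompletion E)] (μw : Measure (w.1.adicCompletion E)) [μw.IsAddHaarMeasure]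
  (A : GL (Fin 2) (UnitaryGroup.LocalRing E v)) (hA : A.val = !![1 - Pi.single w 1, Pi.single w 1; Pi.single w 1, 1 - Pi.single w 1])
  (κ'' : ℂ) {F₄ : UnitaryGroup.localPi E c (2 + 2) J₂D v → ℂ}
  (hF₄ : ∀ g, F₄ g = κ'' * ∫ ζ, F'' (FrameTransport.frameConj F E c v (2 + 2) hJ₂D (antidiagonal_over_eq_map F E 2) Q hQ
      (toLocalFour F E c v (leviElt (UnitaryGroup.LocalRing E v) (UnitaryGroup.conjLocal E c v) (UnitaryGroup.conjLocal_conjLocal c v hcδ hδ) A)) *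
    FrameTransport.frameConj F E c v (2 + 2) hJ₂D (antidiagonal_over_eq_map F E 2) Q hQ
      (toLocalFour F E c v (uMinus (UnitaryGroup.LocalRing E v) (UnitaryGroup.conjLocal E c v) (UnitaryGroup.conjLocal_conjLocal c v hcδ hδ) (Pi.single w ζ))) * g) ∂μw)

include hd hT₂ hDD hQm hf hF'' hw hA hF₄ in
/-- **THE LONG-ROOT `SL₂` RELATION OF `F₄ = κ″ ℬ_w F″` (non-split), EVALUATED**: for `x ∈ F_vˣ`,
`F₄(φ(w₂) u(x) g) = [χ⁰_s₀(φ t(−δ⁻¹,1)) ∏_w ‖δ_w‖] · χ⁰_{F,v}(x)⁻¹ · |x|_v^{−2s₀} · F₄(ū(x⁻¹) g)` (★ B4d-1b `apply_weylTwo_uLongTwo_coord` with the invariance and the swapped torus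
law of ★ B7-B, valued by ★ B7-V `thetaB_atom`). [cite: HarrisKudlaSweet1996, §6 (6.16)] [cite: Casselman1980, §3 Thm. 3.1] -/
theorem hrel_long_of_forall_eq (x : (v.adicCompletion F)ˣ) (g : UnitaryGroup.localPi E c (2 + 2) J₂D v) :
    F₄ (FrameTransport.frameConj F E c v (2 + 2) hJ₂D (antidiagonal_over_eq_map F E 2) Q hQ
          (toLocalFour F E c v (weylTwo (UnitaryGroup.LocalRing E v) (UnitaryGroup.conjLocal E c v))) *
        FrameTransport.frameConj F E c v (2 + 2) hJ₂D (antidiagonal_over_eq_map F E 2) Q hQ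
          (toLocalFour F E c v (uLongTwo (UnitaryGroup.LocalRing E v) (UnitaryGroup.conjLocal E c v)
            (UnitaryGroup.toLocalRing E v (x : v.adicCompletion F) * algebraMap E (UnitaryGroup.LocalRing E v) δ) (conjLocal_coord F E c hcδ v x))) * g) =
      localSiegelCharacter F E c v 2 χv₀ s₀ (FrameTransport.frameConj F E c v (2 + 2) hJ₂D (antidiagonal_over_eq_map F E 2) Q hQ (toLocalFour F E c v
          (torusElt (UnitaryGroup.LocalRing E v) (UnitaryGroup.conjLocal E c v) (UnitaryGroup.conjLocal_conjLocal c v hcδ hδ)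
            (-((Units.mk0 δ hδ).map (algebraMap E (UnitaryGroup.LocalRing E v) : E →* UnitaryGroup.LocalRing E v))⁻¹) 1))) *
        ((∏ w' : PlacesOver E v, ‖algebraMap E (UnitaryGroup.LocalRing E v) δ w'‖ : ℝ) : ℂ) *
        ((((chiF F E v χv₀ x)⁻¹ : ℂˣ) : ℂ) * ((normAbs (v.adicCompletion F) (x : v.adicCompletion F) : ℝ) : ℂ) ^ (-(2 * s₀))) *
        F₄ (FrameTransport.frameConj F E c v (2 + 2) hJ₂D (antidiagonal_over_eq_map F E 2) Q hQ
              (toLocalFour F E c v (weylTwo (UnitaryGroup.LocalRing E v) (UnitaryGroup.conjLocal E c v))) *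
            FrameTransport.frameConj F E c v (2 + 2) hJ₂D (antidiagonal_over_eq_map F E 2) Q hQ
              (toLocalFour F E c v (uLongTwo (UnitaryGroup.LocalRing E v) (UnitaryGroup.conjLocal E c v)
                (UnitaryGroup.toLocalRing E v ((x⁻¹ : (v.adicCompletion F)ˣ) : v.adicCompletion F) * algebraMap E (UnitaryGroup.LocalRing E v) δ⁻¹)
                (conjLocal_coord_inv F E c hcδ v _))) *
            FrameTransport.frameConj F E c v (2 + 2) hJ₂D (antidiagonal_over_eq_map F E 2) Q hQ
              (toLocalFour F E c v (weylTwo (UnitaryGroup.LocalRing E v) (UnitaryGroup.conjLocal E c v))) * g) := by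
  -- invariance under `φ(u_{2e₂})` and the swapped torus law of `F₄`, from ★ B7-B on the structure of `F″` (★ B7-CB)
  have hU : ∀ (r : UnitaryGroup.LocalRing E v) (hr : UnitaryGroup.conjLocal E c v r = -r) (g : UnitaryGroup.localPi E c (2 + 2) J₂D v),
      F₄ (FrameTransport.frameConj F E c v (2 + 2) hJ₂D (antidiagonal_over_eq_map F E 2) Q hQ (toLocalFour F E c v (uLongTwo (UnitaryGroup.LocalRing E v) (UnitaryGroup.conjLocal E c v) r hr)) * g) = F₄ g := by
    intro r hr g
    have h := stageShort_apply_nSiegelBlk F E c hcδ hδ v hJ₂D Q hQ w μw F'' A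
      (apply_nSiegelBlk F E c hcδ hδ hd v hT₂ hJ₂D D Dinv hDD Q hQm hQ μF χv₀ s₀ hf κ hF'') _
      (isSkewTwo_coords (UnitaryGroup.conjLocal_conjLocal c v hcδ hδ) r 0 0 hr (by rw [map_zero, neg_zero])) g
    rw [← nSiegel_eq_nSiegelBlk (UnitaryGroup.LocalRing E v) (UnitaryGroup.conjLocal E c v) (UnitaryGroup.conjLocal_conjLocal c v hcδ hδ) r 0 0 hr (by rw [map_zero, neg_zero]),
      nSiegel, uPlus_zero, uLongOne_zero, mul_one, mul_one] at h
    rw [hF₄, hF₄, h]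
  have hT' : ∀ (a b : (UnitaryGroup.LocalRing E v)ˣ) (g : UnitaryGroup.localPi E c (2 + 2) J₂D v),
      F₄ (FrameTransport.frameConj F E c v (2 + 2) hJ₂D (antidiagonal_over_eq_map F E 2) Q hQ (toLocalFour F E c v (torusElt (UnitaryGroup.LocalRing E v) (UnitaryGroup.conjLocal E c v) (UnitaryGroup.conjLocal_conjLocal c v hcδ hδ) a b)) * g) =
        localSiegelCharacter F E c v 2 χv₀ s₀ (FrameTransport.frameConj F E c v (2 + 2) hJ₂D (antidiagonal_over_eq_map F E 2) Q hQ (toLocalFour F E c v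
            (torusElt (UnitaryGroup.LocalRing E v) (UnitaryGroup.conjLocal E c v) (UnitaryGroup.conjLocal_conjLocal c v hcδ hδ) (a * (Units.map (MonoidHom.mulSingle (fun w' : PlacesOver E v => w'.1.adicCompletion E) w) (Units.map (Pi.evalMonoidHom (fun w' : PlacesOver E v => w'.1.adicCompletion E) w) a))⁻¹ * Units.map (MonoidHom.mulSingle (fun w' : PlacesOver E v => w'.1.adicCompletion E) w) (Units.map (Pi.evalMonoidHom (fun w' : PlacesOver E v => w'.1.adicCompletion E) w) b))
              (Units.map (UnitaryGroup.conjLocal E c v : UnitaryGroup.LocalRing E v →* UnitaryGroup.LocalRing E v) (b * (Units.map (MonoidHom.mulSingle (fun w' : PlacesOver E v => w'.1.adicCompletion E) w) (Units.map (Pi.evalMonoidHom (fun w' : PlacesOver E v => w'.1.adicCompletion E) w) b))⁻¹ * Units.map (MonoidHom.mulSingle (fun w' : PlacesOver E v => w'.1.adicCompletion E) w) (Units.map (Pi.evalMonoidHom (fun w' : PlacesOver E v => w'.1.adicCompletion E) w) a))⁻¹)))) *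
          ((∏ w' : PlacesOver E v, ‖(((b * (Units.map (MonoidHom.mulSingle (fun w' : PlacesOver E v => w'.1.adicCompletion E) w) (Units.map (Pi.evalMonoidHom (fun w' : PlacesOver E v => w'.1.adicCompletion E) w) b))⁻¹ * Units.map (MonoidHom.mulSingle (fun w' : PlacesOver E v => w'.1.adicCompletion E) w) (Units.map (Pi.evalMonoidHom (fun w' : PlacesOver E v => w'.1.adicCompletion E) w) a)) : (UnitaryGroup.LocalRing E v)ˣ) : UnitaryGroup.LocalRing E v) w'‖ : ℝ) : ℂ) *
          ((‖(a : UnitaryGroup.LocalRing E v) w‖ * ‖(b : UnitaryGroup.LocalRing E v) w‖⁻¹ : ℝ) : ℂ) * F₄ g := by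
    intro a b g
    rw [hF₄, hF₄, stageShort_apply_torusElt F E c hcδ hδ v hJ₂D Q hQ w μw F'' _ A hA
      (apply_torusElt F E c hcδ hδ hd v hT₂ hJ₂D D Dinv hDD Q hQm hQ μF χv₀ s₀ hf κ hF'') a b g]
    ring
  rw [apply_weylTwo_uLongTwo_coord F E c hcδ hδ v hJ₂D Q hQ F₄ _ hU hT' x g]
  -- the value of the swapped torus law at `(1, −X⁻¹)`
  refine congrArg (fun z : ℂ => z * _) ?_
  simp only [map_one, inv_one, one_mul, mul_one, proj_eq_self_of_forall_eq F E v hw, mul_inv_cancel, Units.val_one, Pi.one_apply, norm_one,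
    Finset.prod_const_one, Complex.ofReal_one]
  rw [← prod_norm_of_forall_eq F E v hw (((-(Units.map (UnitaryGroup.toLocalRing E v : v.adicCompletion F →* UnitaryGroup.LocalRing E v) x *
      (Units.mk0 δ hδ).map (algebraMap E (UnitaryGroup.LocalRing E v) : E →* UnitaryGroup.LocalRing E v))⁻¹ : (UnitaryGroup.LocalRing E v)ˣ) : UnitaryGroup.LocalRing E v)),
    prod_norm_neg_inv, inv_inv, thetaB_atom F E c hcδ hδ hd v hT₂ hJ₂D D Dinv hDD Q hQm hQ χv₀ s₀ x]

end NonSplit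


/-! ## §2 Split: `F₃ = κ′ · ℬ_{w₂} F″`, `F₄ = κ″ · ℬ_{w₁} F₃` -/

section Split

variable (w₁ w₂ : PlacesOver E v) (hne : w₁ ≠ w₂) (hw : ∀ w' : PlacesOver E v, w' = w₁ ∨ w' = w₂)
  [MeasurableSpace (w₂.1.adicCompletion E)] [BorelSpace (w₂.1.adicCompletion E)] (μ₂ : Measure (w₂.1.adicCompletion E)) [μ₂.IsAddHaarMeasure]
  (A₂ : GL (Fin 2) (UnitaryGroup.LocalRing E v)) (hA₂ : A₂.val = !![1 - Pi.single w₂ 1, Pi.single w₂ 1; Pi.single w₂ 1, 1 - Pi.single w₂ 1])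
  (κ' : ℂ) {F₃ : UnitaryGroup.localPi E c (2 + 2) J₂D v → ℂ}
  (hF₃ : ∀ g, F₃ g = κ' * ∫ ζ, F'' (FrameTransport.frameConj F E c v (2 + 2) hJ₂D (antidiagonal_over_eq_map F E 2) Q hQ (toLocalFour F E c v (leviElt (UnitaryGroup.LocalRing E v) (UnitaryGroup.conjLocal E c v) (UnitaryGroup.conjLocal_conjLocal c v hcδ hδ) A₂)) *
    FrameTransport.frameConj F E c v (2 + 2) hJ₂D (antidiagonal_over_eq_map F E 2) Q hQ (toLocalFour F E c v (uMinus (UnitaryGroup.LocalRing E v) (UnitaryGroup.conjLocal E c v) (UnitaryGroup.conjLocal_conjLocal c v hcδ hδ) (Pi.single w₂ ζ))) * g) ∂μ₂)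
  [MeasurableSpace (w₁.1.adicCompletion E)] [BorelSpace (w₁.1.adicCompletion E)] (μ₁ : Measure (w₁.1.adicCompletion E)) [μ₁.IsAddHaarMeasure]
  (A₁ : GL (Fin 2) (UnitaryGroup.LocalRing E v)) (hA₁ : A₁.val = !![1 - Pi.single w₁ 1, Pi.single w₁ 1; Pi.single w₁ 1, 1 - Pi.single w₁ 1])
  (κ'' : ℂ) {F₄ : UnitaryGroup.localPi E c (2 + 2) J₂D v → ℂ}
  (hF₄ : ∀ g, F₄ g = κ'' * ∫ ζ, F₃ (FrameTransport.frameConj F E c v (2 + 2) hJ₂D (antidiagonal_over_eq_map F E 2) Q hQ (toLocalFour F E c v (leviElt (UnitaryGroup.LocalRing E v) (UnitaryGroup.conjLocal E c v) (UnitaryGroup.conjLocal_conjLocal c v hcδ hδ) A₁)) *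
    FrameTransport.frameConj F E c v (2 + 2) hJ₂D (antidiagonal_over_eq_map F E 2) Q hQ (toLocalFour F E c v (uMinus (UnitaryGroup.LocalRing E v) (UnitaryGroup.conjLocal E c v) (UnitaryGroup.conjLocal_conjLocal c v hcδ hδ) (Pi.single w₁ ζ))) * g) ∂μ₁)

omit [MeasurableSpace (v.adicCompletion F)] [BorelSpace (v.adicCompletion F)] [μF.IsAddHaarMeasure] in
/-- a torus law passes to a scalar multiple (bookkeeping). [cite: Casselman1980, §3] -/
theorem apply_torusElt_of_eq_const_mul {T G' : UnitaryGroup.localPi E c (2 + 2) J₂D v → ℂ} {κ₀ : ℂ} (hG' : ∀ g, G' g = κ₀ * T g)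
    {θ : (UnitaryGroup.LocalRing E v)ˣ → (UnitaryGroup.LocalRing E v)ˣ → ℂ}
    (hT : ∀ (a b : (UnitaryGroup.LocalRing E v)ˣ) (g : UnitaryGroup.localPi E c (2 + 2) J₂D v),
      T (FrameTransport.frameConj F E c v (2 + 2) hJ₂D (antidiagonal_over_eq_map F E 2) Q hQ (toLocalFour F E c v (torusElt (UnitaryGroup.LocalRing E v) (UnitaryGroup.conjLocal E c v) (UnitaryGroup.conjLocal_conjLocal c v hcδ hδ) a b)) * g) = θ a b * T g)
    (a b : (UnitaryGroup.LocalRing E v)ˣ) (g : UnitaryGroup.localPi E c (2 + 2) J₂D v) :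
    G' (FrameTransport.frameConj F E c v (2 + 2) hJ₂D (antidiagonal_over_eq_map F E 2) Q hQ (toLocalFour F E c v (torusElt (UnitaryGroup.LocalRing E v) (UnitaryGroup.conjLocal E c v) (UnitaryGroup.conjLocal_conjLocal c v hcδ hδ) a b)) * g) = θ a b * G' g := by
  rw [hG', hG', hT]; ring

include hd hT₂ hDD hQm hf hF'' hne hw hA₂ hF₃ hA₁ hF₄ in
/-- **THE LONG-ROOT `SL₂` RELATION OF `F₄ = κ″ ℬ_{w₁}(κ′ ℬ_{w₂} F″)` (split), EVALUATED** — the same datum as in the non-split case: the two swaps recompose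
`b = ms_{w₁}(b_{w₁}) ms_{w₂}(b_{w₂})` and the Jacobians give `(∏_w ‖b_w‖)⁻¹`. [cite: HarrisKudlaSweet1996, §6 (6.16)] [cite: Casselman1980, §3 Thm. 3.1] -/
theorem hrel_long_of_pair (x : (v.adicCompletion F)ˣ) (g : UnitaryGroup.localPi E c (2 + 2) J₂D v) :
    F₄ (FrameTransport.frameConj F E c v (2 + 2) hJ₂D (antidiagonal_over_eq_map F E 2) Q hQ (toLocalFour F E c v (weylTwo (UnitaryGroup.LocalRing E v) (UnitaryGroup.conjLocal E c v))) *
        FrameTransport.frameConj F E c v (2 + 2) hJ₂D (antidiagonal_over_eq_map F E 2) Q hQ (toLocalFour F E c v (uLongTwo (UnitaryGroup.LocalRing E v) (UnitaryGroup.conjLocal E c v)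
            (UnitaryGroup.toLocalRing E v (x : v.adicCompletion F) * algebraMap E (UnitaryGroup.LocalRing E v) δ) (conjLocal_coord F E c hcδ v x))) * g) =
      localSiegelCharacter F E c v 2 χv₀ s₀ (FrameTransport.frameConj F E c v (2 + 2) hJ₂D (antidiagonal_over_eq_map F E 2) Q hQ (toLocalFour F E c v
          (torusElt (UnitaryGroup.LocalRing E v) (UnitaryGroup.conjLocal E c v) (UnitaryGroup.conjLocal_conjLocal c v hcδ hδ)
            (-((Units.mk0 δ hδ).map (algebraMap E (UnitaryGroup.LocalRing E v) : E →* UnitaryGroup.LocalRing E v))⁻¹) 1))) *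
        ((∏ w' : PlacesOver E v, ‖algebraMap E (UnitaryGroup.LocalRing E v) δ w'‖ : ℝ) : ℂ) *
        ((((chiF F E v χv₀ x)⁻¹ : ℂˣ) : ℂ) * ((normAbs (v.adicCompletion F) (x : v.adicCompletion F) : ℝ) : ℂ) ^ (-(2 * s₀))) *
        F₄ (FrameTransport.frameConj F E c v (2 + 2) hJ₂D (antidiagonal_over_eq_map F E 2) Q hQ (toLocalFour F E c v (weylTwo (UnitaryGroup.LocalRing E v) (UnitaryGroup.conjLocal E c v))) *
            FrameTransport.frameConj F E c v (2 + 2) hJ₂D (antidiagonal_over_eq_map F E 2) Q hQ (toLocalFour F E c v (uLongTwo (UnitaryGroup.LocalRing E v) (UnitaryGroup.conjLocal E c v)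
                (UnitaryGroup.toLocalRing E v ((x⁻¹ : (v.adicCompletion F)ˣ) : v.adicCompletion F) * algebraMap E (UnitaryGroup.LocalRing E v) δ⁻¹)
                (conjLocal_coord_inv F E c hcδ v _))) *
            FrameTransport.frameConj F E c v (2 + 2) hJ₂D (antidiagonal_over_eq_map F E 2) Q hQ (toLocalFour F E c v (weylTwo (UnitaryGroup.LocalRing E v) (UnitaryGroup.conjLocal E c v))) * g) := by
  have hU : ∀ (r : UnitaryGroup.LocalRing E v) (hr : UnitaryGroup.conjLocal E c v r = -r) (g : UnitaryGroup.localPi E c (2 + 2) J₂D v),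
      F₄ (FrameTransport.frameConj F E c v (2 + 2) hJ₂D (antidiagonal_over_eq_map F E 2) Q hQ (toLocalFour F E c v (uLongTwo (UnitaryGroup.LocalRing E v) (UnitaryGroup.conjLocal E c v) r hr)) * g) = F₄ g := by
    intro r hr g
    have h := stageShort_apply_nSiegelBlk F E c hcδ hδ v hJ₂D Q hQ w₁ μ₁ F₃ A₁
      (apply_nSiegelBlk₂ F E c hcδ hδ hd v hT₂ hJ₂D D Dinv hDD Q hQm hQ μF χv₀ s₀ hf κ hF'' w₂ μ₂ A₂ κ' hF₃) _
      (isSkewTwo_coords (UnitaryGroup.conjLocal_conjLocal c v hcδ hδ) r 0 0 hr (by rw [map_zero, neg_zero])) g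
    rw [← nSiegel_eq_nSiegelBlk (UnitaryGroup.LocalRing E v) (UnitaryGroup.conjLocal E c v) (UnitaryGroup.conjLocal_conjLocal c v hcδ hδ) r 0 0 hr (by rw [map_zero, neg_zero]),
      nSiegel, uPlus_zero, uLongOne_zero, mul_one, mul_one] at h
    rw [hF₄, hF₄, h]
  have hT₃ := stageShort_apply_torusElt F E c hcδ hδ v hJ₂D Q hQ w₁ μ₁ F₃ _ A₁ hA₁
      (apply_torusElt₂ F E c hcδ hδ hd v hT₂ hJ₂D D Dinv hDD Q hQm hQ μF χv₀ s₀ hf κ hF'' w₂ μ₂ A₂ hA₂ κ' hF₃)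
  have hT' := apply_torusElt_of_eq_const_mul F E c hcδ hδ v hJ₂D Q hQ
    (T := fun g => ∫ ζ, F₃ (FrameTransport.frameConj F E c v (2 + 2) hJ₂D (antidiagonal_over_eq_map F E 2) Q hQ (toLocalFour F E c v (leviElt (UnitaryGroup.LocalRing E v) (UnitaryGroup.conjLocal E c v) (UnitaryGroup.conjLocal_conjLocal c v hcδ hδ) A₁)) *
      FrameTransport.frameConj F E c v (2 + 2) hJ₂D (antidiagonal_over_eq_map F E 2) Q hQ (toLocalFour F E c v (uMinus (UnitaryGroup.LocalRing E v) (UnitaryGroup.conjLocal E c v) (UnitaryGroup.conjLocal_conjLocal c v hcδ hδ) (Pi.single w₁ ζ))) * g) ∂μ₁)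
    hF₄ hT₃
  rw [apply_weylTwo_uLongTwo_coord F E c hcδ hδ v hJ₂D Q hQ F₄ _ hU hT' x g]
  refine congrArg (fun z : ℂ => z * _) ?_
  -- the unit algebra at `b = −X⁻¹`: the two projections recompose `b`, the Jacobians give `(∏_w ‖b_w‖)⁻¹ = ∏_w ‖X_w‖`
  set b : (UnitaryGroup.LocalRing E v)ˣ := -(Units.map (UnitaryGroup.toLocalRing E v : v.adicCompletion F →* UnitaryGroup.LocalRing E v) x * (Units.mk0 δ hδ).map (algebraMap E (UnitaryGroup.LocalRing E v) : E →* UnitaryGroup.LocalRing E v))⁻¹ with hb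
  have h1 : Units.map (MonoidHom.mulSingle (fun w' : PlacesOver E v => w'.1.adicCompletion E) w₁) (Units.map (Pi.evalMonoidHom (fun w' : PlacesOver E v => w'.1.adicCompletion E) w₁) b) * Units.map (MonoidHom.mulSingle (fun w' : PlacesOver E v => w'.1.adicCompletion E) w₂) (Units.map (Pi.evalMonoidHom (fun w' : PlacesOver E v => w'.1.adicCompletion E) w₂) b) = b := proj_mul_proj_of_pair F E v hne hw b
  have h2 : b * (Units.map (MonoidHom.mulSingle (fun w' : PlacesOver E v => w'.1.adicCompletion E) w₁) (Units.map (Pi.evalMonoidHom (fun w' : PlacesOver E v => w'.1.adicCompletion E) w₁) b))⁻¹ * (Units.map (MonoidHom.mulSingle (fun w' : PlacesOver E v => w'.1.adicCompletion E) w₂) (Units.map (Pi.evalMonoidHom (fun w' : PlacesOver E v => w'.1.adicCompletion E) w₂) b))⁻¹ = 1 := by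
    rw [mul_assoc, ← mul_inv, h1, mul_inv_cancel]
  have hπinv : (((Units.map (MonoidHom.mulSingle (fun w' : PlacesOver E v => w'.1.adicCompletion E) w₁) (Units.map (Pi.evalMonoidHom (fun w' : PlacesOver E v => w'.1.adicCompletion E) w₁) b))⁻¹ : (UnitaryGroup.LocalRing E v)ˣ) : UnitaryGroup.LocalRing E v) w₂ = 1 := by
    rw [← map_inv, ← map_inv, proj_apply_of_ne F E v hne]
  have hJ : ‖((b * (Units.map (MonoidHom.mulSingle (fun w' : PlacesOver E v => w'.1.adicCompletion E) w₁) (Units.map (Pi.evalMonoidHom (fun w' : PlacesOver E v => w'.1.adicCompletion E) w₁) b))⁻¹ : (UnitaryGroup.LocalRing E v)ˣ) : UnitaryGroup.LocalRing E v) w₂‖ = ‖(b : UnitaryGroup.LocalRing E v) w₂‖ := by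
    rw [Units.val_mul, Pi.mul_apply, hπinv, mul_one]
  have hN : ((‖(b : UnitaryGroup.LocalRing E v) w₂‖ : ℝ) : ℂ)⁻¹ * ((‖(b : UnitaryGroup.LocalRing E v) w₁‖ : ℝ) : ℂ)⁻¹ =
      ((∏ w' : PlacesOver E v, ‖(((Units.map (UnitaryGroup.toLocalRing E v : v.adicCompletion F →* UnitaryGroup.LocalRing E v) x * (Units.mk0 δ hδ).map (algebraMap E (UnitaryGroup.LocalRing E v) : E →* UnitaryGroup.LocalRing E v)) : (UnitaryGroup.LocalRing E v)ˣ) : UnitaryGroup.LocalRing E v) w'‖ : ℝ) : ℂ) := by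
    rw [← Complex.ofReal_inv, ← Complex.ofReal_inv, ← Complex.ofReal_mul, ← mul_inv, mul_comm, ← prod_norm_of_pair F E v hne hw (b : UnitaryGroup.LocalRing E v), hb,
      prod_norm_neg_inv, inv_inv]
  simp only [map_one, inv_one, one_mul, mul_one, map_mul, map_inv, placeUnit_eval_placeUnit_of_ne F E v (Ne.symm hne),
    Units.val_one, Pi.one_apply, norm_one, Complex.ofReal_one, h1, h2, hJ, proj_apply_of_ne F E v hne, Finset.prod_const_one, Complex.ofReal_inv]
  rw [mul_assoc, hN, hb, thetaB_atom F E c hcδ hδ hd v hT₂ hJ₂D D Dinv hDD Q hQm hQ χv₀ s₀ x]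

end Split

end Summit.HodgeConjecture.HodgeConjecture.Cruxes.HLiu418.K2LiuSiegelCocycleChainLong

end
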